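import Summits.NavierStokesRegularity.NavierStokesRegularity.Theorems.EulerZoomLiouvillePowerGaugeEulerLiouvilleSelfSimilarShvydkoyTail
import Literature.Analysis.FluidPDE.HomogeneousEulerAxisymmetricProofs
import HarnessLib

/-!
# The axisymmetric homogeneous-tail stratum of `stub_selfSimilarExtremal` is closed UNCONDITIONALLY
# (crux `EulerZoomLiouville.PowerGaugeEulerLiouville` = stmt-NavierStokesRegularity-19832, route №10, line `birth`)

Seat ns-typeII-p1 (cell ns-regularity-ideate §B, D-0081); `--supports` stmt-19832.

The lead's `HomogeneousTail.selfSimilar_ae_eq_zero_of_axisymmetric_homogeneous_tail`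
(`…SelfSimilarShvydkoyTail.lean`, p527674) kills an exactly self-similar member of the crux's class
(`0 < ρ < 1/2`) whose `C²/C¹` profile has an AXISYMMETRIC homogeneous tail of the scaling degrees —
CONDITIONALLY on the printed fact `shvydkoy2018_prop51_noAxisymmetric` (Shvydkoy 2018, Prop. 5.1).
That fact is now a tree THEOREM (`shvydkoy2018_prop51_noAxisymmetric_holds`,
`Literature/Analysis/FluidPDE/HomogeneousEulerAxisymmetricProofs.lean`: window `1 < α < 2` by seat
ns-typeII-lit-1, lower range `0 < α < 1` and assembly by this seat), so the stratum closes with no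
hypothesis beyond the crux's:

* `selfSimilar_ae_eq_zero_of_axisymmetric_homogeneous_tail'` — the lead's statement VERBATIM minus
  the fact hypothesis `h51`;
* `selfSimilar_ae_eq_zero_of_axisymmetric_homogeneous_tail_C1` — the same with the `C²` hypotheses
  on the tail dropped (in the crux's window `α = 1 + ρ ∈ (1, 3/2)` Prop. 5.1 holds in the `C¹` class:
  `IsHomogeneousSteadyEuler.eq_zero_of_isAxisymmetric`, `HomogeneousEulerAxisymmetricWindow.lean`).

WHAT THIS IS NOT: not NS regularity, not the crux, not `stub_selfSimilarExtremal` — one stratum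
(axisymmetric tails homogeneous OUTSIDE A BALL) of the registered residue; the generic critical-tail
profile `|V| ≍ |y|^{-(1+ρ)}` without exact homogeneity or symmetry is untouched. [folklore]
-/

noncomputable section

-- the summit and its single problem share the name `NavierStokesRegularity` (D-0017 nested layout)
set_option linter.dupNamespace false

open MeasureTheory Set Filter Topology Metric Function TopologicalSpace
open scoped ENNReal NNReal

namespace Summit.NavierStokesRegularity.NavierStokesRegularity.Theorems.PowerGaugeEulerLiouville

open Literature.Analysis Literature.Analysis.FunctionSpaces Literature.Analysis.FluidPDE

namespace HomogeneousTail

/-- **Axisymmetric `C²` homogeneous tails are excluded, unconditionally** (`0 < ρ < 1/2`): the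
lead's `selfSimilar_ae_eq_zero_of_axisymmetric_homogeneous_tail` with its hypothesis
`h51 : shvydkoy2018_prop51_noAxisymmetric` discharged by the tree theorem
`shvydkoy2018_prop51_noAxisymmetric_holds`. [cite: Shvydkoy2018, Prop 5.1] -/
theorem selfSimilar_ae_eq_zero_of_axisymmetric_homogeneous_tail' {ρ : ℝ} (hρ : 0 < ρ)
    (hρ2 : ρ < 1 / 2)
    {u : ℝ → EuclideanSpace ℝ (Fin 3) → EuclideanSpace ℝ (Fin 3)} {p : ℝ → EuclideanSpace ℝ (Fin 3) → ℝ}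
    {H : ℝ → EuclideanSpace ℝ (Fin 3) → EuclideanSpace ℝ (Fin 3) →L[ℝ] EuclideanSpace ℝ (Fin 3)} {c : ℝ≥0}
    (hsw : IsSuitableWeakSolutionOn (slab (EuclideanSpace ℝ (Fin 3)) (Iio 0) isOpen_Iio) 0 0 u p)
    (hH : HasWeakSpatialGradientOn (slab (EuclideanSpace ℝ (Fin 3)) (Iio 0) isOpen_Iio) u H)
    (hgauge : ∀ a : ℝ, 0 < a →
      ENNReal.ofReal (a ^ (2 * ρ)) * cknA a (0 : ℝ × EuclideanSpace ℝ (Fin 3)) u +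
          ENNReal.ofReal (a ^ ρ) * cknE a (0 : ℝ × EuclideanSpace ℝ (Fin 3)) H +
        ENNReal.ofReal (a ^ (2 * ρ)) * cknD a (0 : ℝ × EuclideanSpace ℝ (Fin 3)) p ≤ (c : ℝ≥0∞))
    {V W : EuclideanSpace ℝ (Fin 3) → EuclideanSpace ℝ (Fin 3)} {P Q : EuclideanSpace ℝ (Fin 3) → ℝ} {R : ℝ}
    (hu : ∀ τ : ℝ, τ < 0 → u τ = selfSimilarCollapse (1 / (2 + ρ)) 0 V τ)
    (hp : ∀ τ : ℝ, τ < 0 → p τ = selfSimilarCollapsePressure (1 / (2 + ρ)) 0 P τ)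
    (hprof : IsSelfSimilarEulerProfile (1 / (2 + ρ)) 0 V P)
    (hW : ∀ ⦃c : ℝ⦄, 0 < c → ∀ ⦃x : EuclideanSpace ℝ (Fin 3)⦄, x ≠ 0 → W (c • x) = c ^ (-(1 + ρ)) • W x)
    (hQ : ∀ ⦃c : ℝ⦄, 0 < c → ∀ ⦃x : EuclideanSpace ℝ (Fin 3)⦄, x ≠ 0 →
      Q (c • x) = c ^ (-(2 * (1 + ρ))) * Q x)
    (hVW : ∀ ⦃y : EuclideanSpace ℝ (Fin 3)⦄, R < ‖y‖ → V y = W y)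
    (hPQ : ∀ ⦃y : EuclideanSpace ℝ (Fin 3)⦄, R < ‖y‖ → P y = Q y)
    (hWC2 : ContDiffOn ℝ 2 W {x | x ≠ 0}) (hQC2 : ContDiffOn ℝ 2 Q {x | x ≠ 0})
    (hax : IsAxisymmetric W) (haxQ : IsAxisymmetricScalar Q) :
    uncurry u =ᵐ[volume.restrict (Iio (0 : ℝ) ×ˢ (univ : Set (EuclideanSpace ℝ (Fin 3))))] 0 :=
  selfSimilar_ae_eq_zero_of_axisymmetric_homogeneous_tail shvydkoy2018_prop51_noAxisymmetric_holds
    hρ hρ2 hsw hH hgauge hu hp hprof hW hQ hVW hPQ hWC2 hQC2 hax haxQ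

/-- **Axisymmetric homogeneous tails are excluded in the `C¹` class** (`0 < ρ < 1/2`): as above,
without the `C²` hypotheses on the tail — in the window `α = 1 + ρ ∈ (1, 2)` Prop. 5.1 holds for the
`C¹` class `IsHomogeneousSteadyEuler` (`IsHomogeneousSteadyEuler.eq_zero_of_isAxisymmetric`), and the
plug `selfSimilar_ae_eq_zero_of_homogeneous_tail_of_exclusion` takes any such exclusion.
[cite: Shvydkoy2018, Prop 5.1] -/
theorem selfSimilar_ae_eq_zero_of_axisymmetric_homogeneous_tail_C1 {ρ : ℝ} (hρ : 0 < ρ)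
    (hρ2 : ρ < 1 / 2)
    {u : ℝ → EuclideanSpace ℝ (Fin 3) → EuclideanSpace ℝ (Fin 3)} {p : ℝ → EuclideanSpace ℝ (Fin 3) → ℝ}
    {H : ℝ → EuclideanSpace ℝ (Fin 3) → EuclideanSpace ℝ (Fin 3) →L[ℝ] EuclideanSpace ℝ (Fin 3)} {c : ℝ≥0}
    (hsw : IsSuitableWeakSolutionOn (slab (EuclideanSpace ℝ (Fin 3)) (Iio 0) isOpen_Iio) 0 0 u p)
    (hH : HasWeakSpatialGradientOn (slab (EuclideanSpace ℝ (Fin 3)) (Iio 0) isOpen_Iio) u H)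
    (hgauge : ∀ a : ℝ, 0 < a →
      ENNReal.ofReal (a ^ (2 * ρ)) * cknA a (0 : ℝ × EuclideanSpace ℝ (Fin 3)) u +
          ENNReal.ofReal (a ^ ρ) * cknE a (0 : ℝ × EuclideanSpace ℝ (Fin 3)) H +
        ENNReal.ofReal (a ^ (2 * ρ)) * cknD a (0 : ℝ × EuclideanSpace ℝ (Fin 3)) p ≤ (c : ℝ≥0∞))
    {V W : EuclideanSpace ℝ (Fin 3) → EuclideanSpace ℝ (Fin 3)} {P Q : EuclideanSpace ℝ (Fin 3) → ℝ} {R : ℝ}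
    (hu : ∀ τ : ℝ, τ < 0 → u τ = selfSimilarCollapse (1 / (2 + ρ)) 0 V τ)
    (hp : ∀ τ : ℝ, τ < 0 → p τ = selfSimilarCollapsePressure (1 / (2 + ρ)) 0 P τ)
    (hprof : IsSelfSimilarEulerProfile (1 / (2 + ρ)) 0 V P)
    (hW : ∀ ⦃c : ℝ⦄, 0 < c → ∀ ⦃x : EuclideanSpace ℝ (Fin 3)⦄, x ≠ 0 → W (c • x) = c ^ (-(1 + ρ)) • W x)
    (hQ : ∀ ⦃c : ℝ⦄, 0 < c → ∀ ⦃x : EuclideanSpace ℝ (Fin 3)⦄, x ≠ 0 →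
      Q (c • x) = c ^ (-(2 * (1 + ρ))) * Q x)
    (hVW : ∀ ⦃y : EuclideanSpace ℝ (Fin 3)⦄, R < ‖y‖ → V y = W y)
    (hPQ : ∀ ⦃y : EuclideanSpace ℝ (Fin 3)⦄, R < ‖y‖ → P y = Q y)
    (hax : IsAxisymmetric W) (haxQ : IsAxisymmetricScalar Q) :
    uncurry u =ᵐ[volume.restrict (Iio (0 : ℝ) ×ˢ (univ : Set (EuclideanSpace ℝ (Fin 3))))] 0 :=
  selfSimilar_ae_eq_zero_of_homogeneous_tail_of_exclusion hρ hρ2 hsw hH hgauge hu hp hprof hW hQ hVW hPQ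
    fun hHSE _ hx => hHSE.eq_zero_of_isAxisymmetric hax haxQ (by linarith) (by linarith) hx

/-- **Axisymmetric homogeneous tails, velocity symmetry only** (`0 < ρ < 1/2`): as
`selfSimilar_ae_eq_zero_of_axisymmetric_homogeneous_tail_C1` but WITHOUT the hypothesis that the
tail pressure `Q` is an axisymmetric scalar — for a homogeneous stationary Euler pair it follows
from the symmetry of the velocity (`IsHomogeneousSteadyEuler.isAxisymmetricScalar_pressure`).
[cite: Shvydkoy2018, Prop 5.1] -/
theorem selfSimilar_ae_eq_zero_of_axisymmetric_homogeneous_tail_velocity {ρ : ℝ} (hρ : 0 < ρ)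
    (hρ2 : ρ < 1 / 2)
    {u : ℝ → EuclideanSpace ℝ (Fin 3) → EuclideanSpace ℝ (Fin 3)} {p : ℝ → EuclideanSpace ℝ (Fin 3) → ℝ}
    {H : ℝ → EuclideanSpace ℝ (Fin 3) → EuclideanSpace ℝ (Fin 3) →L[ℝ] EuclideanSpace ℝ (Fin 3)} {c : ℝ≥0}
    (hsw : IsSuitableWeakSolutionOn (slab (EuclideanSpace ℝ (Fin 3)) (Iio 0) isOpen_Iio) 0 0 u p)
    (hH : HasWeakSpatialGradientOn (slab (EuclideanSpace ℝ (Fin 3)) (Iio 0) isOpen_Iio) u H)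
    (hgauge : ∀ a : ℝ, 0 < a →
      ENNReal.ofReal (a ^ (2 * ρ)) * cknA a (0 : ℝ × EuclideanSpace ℝ (Fin 3)) u +
          ENNReal.ofReal (a ^ ρ) * cknE a (0 : ℝ × EuclideanSpace ℝ (Fin 3)) H +
        ENNReal.ofReal (a ^ (2 * ρ)) * cknD a (0 : ℝ × EuclideanSpace ℝ (Fin 3)) p ≤ (c : ℝ≥0∞))
    {V W : EuclideanSpace ℝ (Fin 3) → EuclideanSpace ℝ (Fin 3)} {P Q : EuclideanSpace ℝ (Fin 3) → ℝ} {R : ℝ}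
    (hu : ∀ τ : ℝ, τ < 0 → u τ = selfSimilarCollapse (1 / (2 + ρ)) 0 V τ)
    (hp : ∀ τ : ℝ, τ < 0 → p τ = selfSimilarCollapsePressure (1 / (2 + ρ)) 0 P τ)
    (hprof : IsSelfSimilarEulerProfile (1 / (2 + ρ)) 0 V P)
    (hW : ∀ ⦃c : ℝ⦄, 0 < c → ∀ ⦃x : EuclideanSpace ℝ (Fin 3)⦄, x ≠ 0 → W (c • x) = c ^ (-(1 + ρ)) • W x)
    (hQ : ∀ ⦃c : ℝ⦄, 0 < c → ∀ ⦃x : EuclideanSpace ℝ (Fin 3)⦄, x ≠ 0 →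
      Q (c • x) = c ^ (-(2 * (1 + ρ))) * Q x)
    (hVW : ∀ ⦃y : EuclideanSpace ℝ (Fin 3)⦄, R < ‖y‖ → V y = W y)
    (hPQ : ∀ ⦃y : EuclideanSpace ℝ (Fin 3)⦄, R < ‖y‖ → P y = Q y)
    (hax : IsAxisymmetric W) :
    uncurry u =ᵐ[volume.restrict (Iio (0 : ℝ) ×ˢ (univ : Set (EuclideanSpace ℝ (Fin 3))))] 0 :=
  selfSimilar_ae_eq_zero_of_homogeneous_tail_of_exclusion hρ hρ2 hsw hH hgauge hu hp hprof hW hQ hVW hPQ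
    fun hHSE _ hx => hHSE.eq_zero_of_isAxisymmetric_velocity_of_one_lt hax (by linarith) (by linarith) hx

end HomogeneousTail

end Summit.NavierStokesRegularity.NavierStokesRegularity.Theorems.PowerGaugeEulerLiouville

end
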